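import Literature.AlgebraicGeometry.AbelianSchemes.AbelianSchemeQuotientPoincareGraphPullback
import Literature.AlgebraicGeometry.AbelianSchemes.AbelianSchemeQuotientHomDescent
import Literature.AlgebraicGeometry.AbelianSchemes.AbelianSchemeQuotientMulNDescent
import Literature.AlgebraicGeometry.AbelianSchemes.IsLambdaOfAtSqOfGraphPullback
import Literature.AlgebraicGeometry.AbelianSchemes.IsLambdaOfAtSymmetricMulSelf
import Literature.AlgebraicGeometry.AbelianSchemes.PoincareUnitHypothesisDescent
import HarnessLib

/-!
# (X-amp-1) AT THE QUOTIENT: a symmetric witness `E₄` of `λ̄_B⁴` for the descended polarisation `λ_B` of `B = A/K`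

Layer `Literature/AlgebraicGeometry/AbelianSchemes`, namespace `Literature.AlgebraicGeometry.AbelianSchemes.AbelianSchemeOver`.
THEOREMS ONLY.  Cell `hodgecm-mathlib`, Hecke-link socket (B), (X-amp) plan of record (B-plan1 (g14) 21:50:29Z / 22:27:10Z):
★ `exists_isLambdaOfAt_mul_self_of_graphPullback` ((X-amp-1) part C) and ★ `IsLambdaOfAt.exists_symmetric_pow_four` ((X1-D4))
INSTANTIATED at the two-step descent `ψ : A → B := A/K`, `ψ̂ : Â → B̂ := Â/K′`, `D_B := dualPairOfQuotientRigidified` (★), `λ_B :=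
polarizationDesc λ` (★), `π := mulNDesc` (★, `π ≫ ψ = [n]_B`), with the inputs discharged by name: `hN` = ★
`nonempty_pullback_whiskerRight_whiskerLeft_poincareQuotRigid_iso` (B-p20), `ψ ≫ λ_B = λ ≫ ψ̂` = ★ `quotientMk_comp_polarizationDesc`,
`λ_B` a homomorphism = ★ `isMonHom_polarizationDesc`, and the unit hypothesis `hD_B` of `D_B` = ★
`DualPair.nonempty_unitHatSlice_iso_of_pullback_whiskerLeft_iso` fed with ★ `nonempty_pullback_whiskerLeft_poincareQuotRigid_iso` and the
unit hypothesis `hD` of `D` upstairs (★ `Polarization.nonempty_unitHatSlice_iso` for a polarised `A`).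

* §1 `nonempty_unitHatSlice_dualPairOfQuotientRigidified_iso` — **`hD_B` from `hD`**;
* §2 `whiskerRight_comp_whiskerLeft_left_fst` / `_snd` — the two projections of `ψ × ψ̂ := (ψ ▷ Â) ≫ (B ◁ ψ̂)`;
* §3 **`exists_isLambdaOfAt_polarizationDesc_sq`** (`∃ E, IsLambdaOfAt s D_B (λ_B ^ 2) E`) and
  **`exists_symmetric_isLambdaOfAt_polarizationDesc_pow_four`** (`∃ E₄, IsLambdaOfAt s D_B (λ_B ^ 4) E₄ ∧ (−1)^*E₄ ∼ E₄`) at every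
  geometric point `s` with `n ≠ 0` in `Ω`, from a witness `Θ′` of `λ̄` upstairs and `ψ_s` onto on `Ω`-points (the standard `hsurj`
  binder of the socket-(B) files).
[MumfordAV1970] §23 (p. 231), §15 Thm. 1 (p. 143), §8 (pp. 74–75); [MumfordFogartyKirwan1994] Ch. 6 §2 Prop. 6.10 (p. 121).

HC_CM is proved only modulo the 7 printed citations until rung 0 closes; nothing here is about HC.

## References
* [MumfordAV1970] D. Mumford, *Abelian Varieties* (1970), §8 (pp. 74–75), §15 Thm. 1 (p. 143), §23 (p. 231).
* [MumfordFogartyKirwan1994] D. Mumford, J. Fogarty, F. Kirwan, *Geometric Invariant Theory*, 3rd ed. (1994), Ch. 6 §2 Prop. 6.10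
  (p. 121).
-/

noncomputable section

universe u

open CategoryTheory CategoryTheory.Limits AlgebraicGeometry MonoidalCategory CartesianMonoidalCategory
open scoped MonObj

-- `Scheme.Modules` / `SheafOfModules` are not reducible (as in Mathlib's `AlgebraicGeometry/Modules/Sheaf.lean`).
set_option backward.isDefEq.respectTransparency false

namespace Literature.AlgebraicGeometry.AbelianSchemes

namespace AbelianSchemeOver

open Literature.AlgebraicGeometry.RelativeSpec Literature.AlgebraicGeometry.AbelianVarieties
  Literature.AlgebraicGeometry.Motives Literature.AlgebraicGeometry.Modules

/-! ## §2 (generic) The two projections of `ψ × ψ̂ := (ψ ▷ Â′) ≫ (B ◁ ψ̂)` -/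

section Projections

variable {S : Scheme.{u}} {A' B Ah Bh : AbelianSchemeOver S} (ψ : A'.X ⟶ B.X) (ψh : Ah.X ⟶ Bh.X)

/-- `(ψ × ψ̂) ≫ pr₁ = pr₁ ≫ ψ`. [cite: MumfordAV1970, §15 Thm. 1 (p. 143)] -/
theorem whiskerRight_comp_whiskerLeft_left_fst :
    ((ψ ▷ Ah.X) ≫ (B.X ◁ ψh)).left ≫ pullback.fst B.X.hom Bh.X.hom = pullback.fst A'.X.hom Ah.X.hom ≫ ψ.left := by
  rw [Over.comp_left, Category.assoc, Over.whiskerLeft_left_fst, Over.whiskerRight_left_fst]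

/-- `(ψ × ψ̂) ≫ pr₂ = pr₂ ≫ ψ̂`. [cite: MumfordAV1970, §15 Thm. 1 (p. 143)] -/
theorem whiskerRight_comp_whiskerLeft_left_snd :
    ((ψ ▷ Ah.X) ≫ (B.X ◁ ψh)).left ≫ pullback.snd B.X.hom Bh.X.hom = pullback.snd A'.X.hom Ah.X.hom ≫ ψh.left := by
  rw [Over.comp_left, Category.assoc, Over.whiskerLeft_left_snd, Over.whiskerRight_left_snd_assoc]

end Projections

variable {S : Scheme.{u}} (A : AbelianSchemeOver S)
  {Y : Scheme.{u}} (u : S ⟶ Y) (K : Subgroup A.Sections) [IsCommMonObj A.X] {n : ℕ}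
  (hK : ∀ σ : K, (σ : A.Sections) ^ n = 1)
  [Finite K] [Y.IsSeparated] [IsSeparated (A.X.hom ≫ u)] [S.IsSeparated]
  (hcov : ∀ x : A.left, ∃ O : (A.translationActionOver u K).StableAffineOpens, x ∈ O.1)
  [LocallyOfFiniteType (A.X.hom ≫ u)] [IsLocallyNoetherian Y]
  (hG : ∃ _ : GrpObj (A.quotientOver u K), IsMonHom (A.quotientMk u K hcov))
  (hsm : Smooth (A.quotientOver u K).hom) (hgc : GeometricallyConnected (A.quotientOver u K).hom)
  (D : A.DualPair) [IsAffine Y]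
  (hfree : ∀ (Ω : Type u) [Field Ω] [IsAlgClosed Ω] (x : Spec (.of Ω) ⟶ A.left) (σ : K), σ ≠ 1 →
    x ≫ (A.translation (σ : A.Sections)).left ≠ x)
  (K' : Subgroup D.hat.Sections) [Finite K'] [IsSeparated (D.hat.X.hom ≫ u)]
  (hcov' : ∀ x : D.hat.left, ∃ O : (D.hat.translationActionOver u K').StableAffineOpens, x ∈ O.1)
  [LocallyOfFiniteType (D.hat.X.hom ≫ u)]
  (hG' : ∃ _ : GrpObj (D.hat.quotientOver u K'), IsMonHom (D.hat.quotientMk u K' hcov'))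
  (hsm' : Smooth (D.hat.quotientOver u K').hom) (hgc' : GeometricallyConnected (D.hat.quotientOver u K').hom)
  (hfree' : ∀ (Ω : Type u) [Field Ω] [IsAlgClosed Ω] (x : Spec (.of Ω) ⟶ D.hat.left) (σ : K'), σ ≠ 1 →
    x ≫ (D.hat.translation (σ : D.hat.Sections)).left ≠ x)
  (Φ : (prodTranslationActionOver (A.quotientBy u K hcov hG hsm hgc) D.hat u K' hcov').EquivariantStructure
    (A.poincarePullback u K hK hcov hG hsm hgc D hfree))
  (h4 : ∀ {T : Scheme.{u}} (f : T ⟶ S) (ℒ : (A.quotientBy u K hcov hG hsm hgc).RigidifiedLineBundle f),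
    ℒ.FibrewisePicZero →
    ∃! g : {g : T ⟶ (D.hat.quotientBy u K' hcov' hG' hsm' hgc').X.left //
        g ≫ (D.hat.quotientBy u K' hcov' hG' hsm' hgc').X.hom = f},
      Nonempty ((Scheme.Modules.pullback ((A.quotientBy u K hcov hG hsm hgc).baseChangeToProd
        (D.hat.quotientBy u K' hcov' hG' hsm' hgc') f g.1 g.2)).obj
          (A.poincareQuotRigid u K hK hcov hG hsm hgc D hfree K' hcov' hG' hsm' hgc' Φ) ≅ ℒ.L))

/-! ## §1 The unit hypothesis of the quotient dual pair -/

include hfree' in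
/-- **`hD_B` FROM `hD`**: `𝒫_B^{rig}|_{B × {ε_B̂}} ≅ 𝒪` for the quotient dual pair `D_B = (B̂, 𝒫_B^{rig})`, from `𝒫|_{A × {ε_Â}} ≅ 𝒪` —
★ `DualPair.nonempty_unitHatSlice_iso_of_pullback_whiskerLeft_iso` fed with ★ `(B ◁ ψ̂)^*𝒫_B^{rig} ≅ 𝒩₁ = (π × 1)^*𝒫` and `η ≫ ψ̂ = η`.
[cite: MumfordFogartyKirwan1994, Ch. 6 §2 Prop. 6.10 (p. 121)] [cite: MumfordAV1970, §15 Thm. 1 (p. 143)] -/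
theorem nonempty_unitHatSlice_dualPairOfQuotientRigidified_iso
    (hD : Nonempty ((Scheme.Modules.pullback (DualPair.unitHatSlice D)).obj D.P ≅ SheafOfModules.unit _)) :
    Nonempty ((Scheme.Modules.pullback (DualPair.unitHatSlice
      (A.dualPairOfQuotientRigidified u K hK hcov hG hsm hgc D hfree K' hcov' hG' hsm' hgc' hfree' Φ h4))).obj
      (A.dualPairOfQuotientRigidified u K hK hcov hG hsm hgc D hfree K' hcov' hG' hsm' hgc' hfree' Φ h4).P ≅
        SheafOfModules.unit _) := by
  letI : GrpObj (D.hat.quotientOver u K') := (D.hat.quotientBy u K' hcov' hG' hsm' hgc').grpObj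
  haveI := D.hat.isMonHom_quotientMk u K' hcov' hG' hsm' hgc'
  exact DualPair.nonempty_unitHatSlice_iso_of_pullback_whiskerLeft_iso D
    (A.dualPairOfQuotientRigidified u K hK hcov hG hsm hgc D hfree K' hcov' hG' hsm' hgc' hfree' Φ h4)
    (A.mulNDesc u K hK hcov)
    (show D.hat.X ⟶ (D.hat.quotientBy u K' hcov' hG' hsm' hgc').X from D.hat.quotientMk u K' hcov')
    (IsMonHom.one_hom _)
    (A.nonempty_pullback_whiskerLeft_poincareQuotRigid_iso u K hK hcov hG hsm hgc D hfree K' hcov' hG' hsm' hgc' hfree' Φ) hD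

/-! ## §3 (X-amp-1) at the quotient -/

variable (lam : A.X ⟶ D.hat.X) [IsMonHom lam]
  (hlam : ∀ σ : K, A.translation (σ : A.Sections) ≫ lam ≫ D.hat.quotientMk u K' hcov' = lam ≫ D.hat.quotientMk u K' hcov')

include hfree hfree' in
/-- **`Λ((ι, λ_B ι)^*𝒫_B^{rig}) = 2λ̄_B` AT THE QUOTIENT**: at a geometric point `s` (`Ω` algebraically closed, `n ≠ 0` in `Ω`; the base
reduced and locally Noetherian), given a witness `Θ′` of `λ̄` upstairs and `ψ_s` onto on `Ω`-points, there is a Cartier divisor `E` on `B_s`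
with `IsLambdaOfAt s D_B (λ_B ^ 2) E` — ★ `exists_isLambdaOfAt_mul_self_of_graphPullback` with every structural input discharged by name
(graph morphism `(ι_s, λ_B ι_s)`). [cite: MumfordAV1970, §23 (p. 231) and §8 (pp. 74–75)] [cite: MumfordFogartyKirwan1994, Ch. 6 §2 Prop. 6.10 (p. 121)] -/
theorem exists_isLambdaOfAt_polarizationDesc_sq [IsReduced S] [IsLocallyNoetherian S]
    (hD : Nonempty ((Scheme.Modules.pullback (DualPair.unitHatSlice D)).obj D.P ≅ SheafOfModules.unit _))
    {Ω : Type u} [Field Ω] [IsAlgClosed Ω] (s : Spec (.of Ω) ⟶ S)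
    (hn : (n : Ω) ≠ 0) {Θ' : CartierDivisor (A.fibre s).toAbelianVariety.X.left} (hΘ' : A.IsLambdaOfAt s D lam Θ')
    (hψs : haveI := A.isMonHom_quotientMk u K hcov hG hsm hgc
      Function.Surjective (AlgPoints.map (L := Ω)
        (fibreHom (A.quotientMk u K hcov : A.X ⟶ (A.quotientBy u K hcov hG hsm hgc).X) s).hom.hom.hom :
        (A.fibre s).toAbelianVariety.Points Ω → ((A.quotientBy u K hcov hG hsm hgc).fibre s).toAbelianVariety.Points Ω)) :
    ∃ E : CartierDivisor ((A.quotientBy u K hcov hG hsm hgc).fibre s).toAbelianVariety.X.left,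
      (A.quotientBy u K hcov hG hsm hgc).IsLambdaOfAt s
        (A.dualPairOfQuotientRigidified u K hK hcov hG hsm hgc D hfree K' hcov' hG' hsm' hgc' hfree' Φ h4)
        ((show (A.quotientBy u K hcov hG hsm hgc).X ⟶ (D.hat.quotientBy u K' hcov' hG' hsm' hgc').X from
          A.polarizationDesc u K hcov D.hat K' hcov' lam hlam) ^ 2) E := by
  letI : GrpObj (A.quotientOver u K) := (A.quotientBy u K hcov hG hsm hgc).grpObj
  letI : GrpObj (D.hat.quotientOver u K') := (D.hat.quotientBy u K' hcov' hG' hsm' hgc').grpObj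
  haveI := A.isMonHom_quotientMk u K hcov hG hsm hgc
  haveI := D.hat.isMonHom_quotientMk u K' hcov' hG' hsm' hgc'
  haveI := A.isMonHom_polarizationDesc u K hcov hG hsm hgc hfree D.hat K' hcov' hG' hsm' hgc' lam hlam
  -- the graph `(ι_s, λ_B ι_s) : B_s → B ×_S B̂` lies over `S`
  have hw : pullback.fst (A.quotientBy u K hcov hG hsm hgc).X.hom s ≫ (A.quotientBy u K hcov hG hsm hgc).X.hom =
      (pullback.fst (A.quotientBy u K hcov hG hsm hgc).X.hom s ≫ (A.polarizationDesc u K hcov D.hat K' hcov' lam hlam).left) ≫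
        (D.hat.quotientBy u K' hcov' hG' hsm' hgc').X.hom := by
    rw [Category.assoc]
    exact (congrArg (fun t => pullback.fst (A.quotientBy u K hcov hG hsm hgc).X.hom s ≫ t)
      (Over.w (A.polarizationDesc u K hcov D.hat K' hcov' lam hlam))).symm
  -- the structural inputs, each cast to the binder text of ★ `exists_isLambdaOfAt_mul_self_of_graphPullback`
  have hψl' : (A.quotientMk u K hcov : A.X ⟶ (A.quotientBy u K hcov hG hsm hgc).X) ≫
      (show (A.quotientBy u K hcov hG hsm hgc).X ⟶
          (A.dualPairOfQuotientRigidified u K hK hcov hG hsm hgc D hfree K' hcov' hG' hsm' hgc' hfree' Φ h4).hat.X from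
        A.polarizationDesc u K hcov D.hat K' hcov' lam hlam) =
      lam ≫ (show D.hat.X ⟶ (A.dualPairOfQuotientRigidified u K hK hcov hG hsm hgc D hfree K' hcov' hG' hsm' hgc' hfree' Φ h4).hat.X
        from D.hat.quotientMk u K' hcov') :=
    A.quotientMk_comp_polarizationDesc u K hcov D.hat K' hcov' lam hlam
  have hπ' : (A.mulNDesc u K hK hcov : (A.quotientBy u K hcov hG hsm hgc).X ⟶ A.X) ≫
      (A.quotientMk u K hcov : A.X ⟶ (A.quotientBy u K hcov hG hsm hgc).X) = (A.quotientBy u K hcov hG hsm hgc).mulN n :=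
    A.mulNDesc_comp_quotientMk u K hK hcov hG hsm hgc hfree
  have hN' : Nonempty ((Scheme.Modules.pullback
      ((((A.quotientMk u K hcov : A.X ⟶ (A.quotientBy u K hcov hG hsm hgc).X) ▷ D.hat.X) ≫
        ((A.quotientBy u K hcov hG hsm hgc).X ◁
          (show D.hat.X ⟶ (A.dualPairOfQuotientRigidified u K hK hcov hG hsm hgc D hfree K' hcov' hG' hsm' hgc' hfree' Φ h4).hat.X
            from D.hat.quotientMk u K' hcov'))).left)).obj
        (A.dualPairOfQuotientRigidified u K hK hcov hG hsm hgc D hfree K' hcov' hG' hsm' hgc' hfree' Φ h4).P ≅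
      (Scheme.Modules.pullback (baseChangeHom (A.mulN n) D.hat.X.hom).left).obj D.P) :=
    A.nonempty_pullback_whiskerRight_whiskerLeft_poincareQuotRigid_iso u K hK hcov hG hsm hgc D hfree K' hcov' hG' hsm' hgc' hfree' Φ
  have hDB := A.nonempty_unitHatSlice_dualPairOfQuotientRigidified_iso u K hK hcov hG hsm hgc D hfree K' hcov' hG' hsm' hgc' hfree' Φ
    h4 hD
  obtain ⟨E, hE, -⟩ := exists_isLambdaOfAt_mul_self_of_graphPullback s D
    (A.dualPairOfQuotientRigidified u K hK hcov hG hsm hgc D hfree K' hcov' hG' hsm' hgc' hfree' Φ h4)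
    (A.quotientMk u K hcov : A.X ⟶ (A.quotientBy u K hcov hG hsm hgc).X) _ lam _ hψl' _
    (whiskerRight_comp_whiskerLeft_left_fst _ _) (whiskerRight_comp_whiskerLeft_left_snd _ _)
    hDB n _ hπ' hN' hn hΘ' hψs
    (pullback.lift (pullback.fst (A.quotientBy u K hcov hG hsm hgc).X.hom s)
      (pullback.fst (A.quotientBy u K hcov hG hsm hgc).X.hom s ≫ (A.polarizationDesc u K hcov D.hat K' hcov' lam hlam).left) hw)
    (pullback.lift_fst _ _ _) (pullback.lift_snd _ _ _)
  exact ⟨E, hE⟩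

include hfree hfree' in
/-- **A SYMMETRIC witness `E₄` of `λ̄_B⁴` at every geometric point** (`n ≠ 0` in `Ω`; `Θ′` a witness of `λ̄` upstairs; `ψ_s` onto on
`Ω`-points): the `hE`/`hEsym` pair of ★ `exists_isAmple_isLambdaOfAt_of_symmetric_witnesses_of_pow` (`m := 4`) at `Q = (B, D_B, λ_B)` —
§3 followed by ★ `IsLambdaOfAt.exists_symmetric_pow_four` (`E₄ := E + (−1)^*E`).
[cite: MumfordAV1970, §23 (p. 231) and §8 (pp. 74–75)] [cite: MumfordFogartyKirwan1994, Ch. 6 §2 Prop. 6.10 (p. 121)] -/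
theorem exists_symmetric_isLambdaOfAt_polarizationDesc_pow_four [IsReduced S] [IsLocallyNoetherian S]
    (hD : Nonempty ((Scheme.Modules.pullback (DualPair.unitHatSlice D)).obj D.P ≅ SheafOfModules.unit _))
    {Ω : Type u} [Field Ω] [IsAlgClosed Ω] (s : Spec (.of Ω) ⟶ S) (hn : (n : Ω) ≠ 0) {Θ' : CartierDivisor (A.fibre s).toAbelianVariety.X.left}
    (hΘ' : A.IsLambdaOfAt s D lam Θ')
    (hψs : haveI := A.isMonHom_quotientMk u K hcov hG hsm hgc
      Function.Surjective (AlgPoints.map (L := Ω)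
        (fibreHom (A.quotientMk u K hcov : A.X ⟶ (A.quotientBy u K hcov hG hsm hgc).X) s).hom.hom.hom :
        (A.fibre s).toAbelianVariety.Points Ω → ((A.quotientBy u K hcov hG hsm hgc).fibre s).toAbelianVariety.Points Ω)) :
    ∃ E₄ : CartierDivisor ((A.quotientBy u K hcov hG hsm hgc).fibre s).toAbelianVariety.X.left,
      (A.quotientBy u K hcov hG hsm hgc).IsLambdaOfAt s
        (A.dualPairOfQuotientRigidified u K hK hcov hG hsm hgc D hfree K' hcov' hG' hsm' hgc' hfree' Φ h4)
        ((show (A.quotientBy u K hcov hG hsm hgc).X ⟶ (D.hat.quotientBy u K' hcov' hG' hsm' hgc').X from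
          A.polarizationDesc u K hcov D.hat K' hcov' lam hlam) ^ 4) E₄ ∧
      (E₄.classPullback (((𝟙 ((A.quotientBy u K hcov hG hsm hgc).fibre s).toAbelianVariety.X)⁻¹ :
        ((A.quotientBy u K hcov hG hsm hgc).fibre s).toAbelianVariety.X ⟶
          ((A.quotientBy u K hcov hG hsm hgc).fibre s).toAbelianVariety.X)).left).LinEquiv E₄ := by
  obtain ⟨E, hE⟩ := A.exists_isLambdaOfAt_polarizationDesc_sq u K hK hcov hG hsm hgc D hfree K' hcov' hG' hsm' hgc' hfree' Φ h4
    lam hlam hD s hn hΘ' hψs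
  exact IsLambdaOfAt.exists_symmetric_pow_four (A.quotientBy u K hcov hG hsm hgc)
    (A.dualPairOfQuotientRigidified u K hK hcov hG hsm hgc D hfree K' hcov' hG' hsm' hgc' hfree' Φ h4) _ s
    (A.nonempty_unitHatSlice_dualPairOfQuotientRigidified_iso u K hK hcov hG hsm hgc D hfree K' hcov' hG' hsm' hgc' hfree' Φ h4 hD)
    hE

end AbelianSchemeOver

end Literature.AlgebraicGeometry.AbelianSchemes

end
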